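import Summits.KontsevichZagierPeriods.KontsevichZagierPeriods.Theses.HyperbolicBloch

/-!
# `IsometryMove` (stmt-KontsevichZagierPeriods-3471) — negative side I: witness kit, parametrised family

Refuter (`cdisprove`) by-products for the crux `IsometryMove` of route `HyperbolicBloch`
(Poincaré extension of `w ↦ (aw+b)/(cw+d)` as ONE change-of-variables move for `[σ, t⁻³]`).
§0: rational boxes / null sets with density `t^{-k}` as `KZ.IntegralRep 3` (`boxRep`, `nullRep`;
`value_boxRep` by Fubini; `∫ t^{-k}` positivity and scaling). §1: the family
`IsometryMoveGen Adm height k` of which the crux is the member `(CruxAdm, cruxHeight, 3)`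
(`isometryMove_iff_gen`, definitional: `num`/`den` are the typed numerator/denominator verbatim),
the diagonal witnesses `a = α, b = c = 0, d = 1` (typed map `= diag(α, αε, height)`,
`formula_diag`) and the MASTER REFUTATION LEMMA `gen_false_of_diag` (soundness
`KZ.Equivalent.value_eq_holds` is the only refutation channel). Consumers:
`Negative/LoadBearing.lean`, `Negative/Tightness.lean`, `Negative/Jacobian.lean`.
[Kontsevich–Zagier 2001, §1.2]
-/

noncomputable section

open MeasureTheory Set MvPolynomial intervalIntegral
open Literature.NumberTheory.Transcendental Literature.ModelTheory.ExponentialFields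

namespace Summit.KontsevichZagierPeriods.HyperbolicBloch.IsometryMoveNegative

open Summit.KontsevichZagierPeriods.KontsevichZagierPeriods (Theses.HyperbolicBloch.IsometryMove)

/-! ## §0 Witness kit -/

/-- The density `p ↦ (p 2)^{-k}` on `ℝ³` (`p 2` = height `t`); `k = 3` is the hyperbolic volume
density of the crux. [folklore] -/
def powDensity (k : ℕ) : (Fin 3 → ℝ) → ℝ := fun p => 1 / p 2 ^ k

/-- Auxiliary: `powDensity_apply`. [folklore] -/
@[simp] theorem powDensity_apply (k : ℕ) (p : Fin 3 → ℝ) : powDensity k p = 1 / p 2 ^ k := rfl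

/-- Open coordinate box `∏ᵢ (lᵢ, uᵢ) ⊆ ℝ³`. [folklore] -/
def box (l u : Fin 3 → ℝ) : Set (Fin 3 → ℝ) := Set.pi univ fun i => Ioo (l i) (u i)

/-- Auxiliary: `mem_box`. [folklore] -/
theorem mem_box {l u : Fin 3 → ℝ} {p : Fin 3 → ℝ} :
    p ∈ box l u ↔ ∀ i, l i < p i ∧ p i < u i := by
  simp [box]

/-- Auxiliary: `pi_univ_eq_biInter`. [folklore] -/
theorem pi_univ_eq_biInter (S : Fin 3 → Set ℝ) :
    Set.pi univ S = ⋂ i ∈ (Finset.univ : Finset (Fin 3)), {p : Fin 3 → ℝ | p i ∈ S i} := by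
  ext p; simp

/-- Auxiliary: `isSemialgebraic_pi`. [folklore] -/
theorem isSemialgebraic_pi (S : Fin 3 → Set ℝ)
    (hS : ∀ i, IsSemialgebraic ℚ {p : Fin 3 → ℝ | p i ∈ S i}) :
    IsSemialgebraic ℚ (Set.pi univ S) := by
  rw [pi_univ_eq_biInter]
  exact IsSemialgebraic.biInter _ _ fun i _ => hS i

/-- Auxiliary: `isSemialgebraic_coord_Ioo`. [folklore] -/
theorem isSemialgebraic_coord_Ioo (i : Fin 3) (l u : ℚ) :
    IsSemialgebraic ℚ {p : Fin 3 → ℝ | p i ∈ Ioo (l : ℝ) u} := by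
  have h := (isSemialgebraic_setOf_eval_lt (k := ℚ) (R := ℝ) (ι := Fin 3) (C l) (X i)).inter
    (isSemialgebraic_setOf_eval_lt (k := ℚ) (R := ℝ) (ι := Fin 3) (X i) (C u))
  have hEq : {p : Fin 3 → ℝ | p i ∈ Ioo (l : ℝ) u} =
      {x : Fin 3 → ℝ | aeval x (C l : MvPolynomial (Fin 3) ℚ) < aeval x (X i : MvPolynomial (Fin 3) ℚ)} ∩
      {x : Fin 3 → ℝ | aeval x (X i : MvPolynomial (Fin 3) ℚ) < aeval x (C u : MvPolynomial (Fin 3) ℚ)} := by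
    ext p; simp
  rw [hEq]; exact h

/-- Auxiliary: `isSemialgebraic_coord_singleton`. [folklore] -/
theorem isSemialgebraic_coord_singleton (i : Fin 3) (q : ℚ) :
    IsSemialgebraic ℚ {p : Fin 3 → ℝ | p i ∈ ({(q : ℝ)} : Set ℝ)} := by
  have h := isSemialgebraic_setOf_eval_eq_zero (k := ℚ) (R := ℝ) (ι := Fin 3) (X i - C q)
  have hEq : {p : Fin 3 → ℝ | p i ∈ ({(q : ℝ)} : Set ℝ)} =
      {x : Fin 3 → ℝ | aeval x (X i - C q : MvPolynomial (Fin 3) ℚ) = 0} := by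
    ext p; simp [sub_eq_zero]
  rw [hEq]; exact h

/-- Boxes with rational corners are `ℚ`-semialgebraic. [folklore] -/
theorem isSemialgebraic_box (l u : Fin 3 → ℚ) :
    IsSemialgebraic ℚ (box (fun i => (l i : ℝ)) (fun i => (u i : ℝ))) :=
  isSemialgebraic_pi _ fun i => isSemialgebraic_coord_Ioo i (l i) (u i)

/-- Auxiliary: `isSemialgebraicFunOn_powDensity`. [folklore] -/
theorem isSemialgebraicFunOn_powDensity {s : Set (Fin 3 → ℝ)} (hs : IsSemialgebraic ℚ s)
    (h0 : ∀ p ∈ s, p 2 ≠ 0) (k : ℕ) : IsSemialgebraicFunOn ℚ s (powDensity k) := by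
  refine (isSemialgebraicFunOn_aeval_div_aeval hs (C 1) (X 2 ^ k) ?_).congr ?_
  · intro p hp; simpa using pow_ne_zero k (h0 p hp)
  · intro p _; simp

/-- Auxiliary: `isSemialgebraicFunOn_powDensity_of_eq_zero`. [folklore] -/
theorem isSemialgebraicFunOn_powDensity_of_eq_zero {s : Set (Fin 3 → ℝ)}
    (hs : IsSemialgebraic ℚ s) (h0 : ∀ p ∈ s, p 2 = 0) {k : ℕ} (hk : k ≠ 0) :
    IsSemialgebraicFunOn ℚ s (powDensity k) := by
  refine (isSemialgebraicFunOn_aeval hs (C 0)).congr ?_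
  intro p hp
  simp [h0 p hp, zero_pow hk]

/-- Auxiliary: `box_subset_Icc`. [folklore] -/
theorem box_subset_Icc (l u : Fin 3 → ℝ) : box l u ⊆ Icc l u :=
  (Set.pi_univ_Ioo_subset l u).trans Ioo_subset_Icc_self

/-- Auxiliary: `continuousOn_powDensity`. [folklore] -/
theorem continuousOn_powDensity (k : ℕ) {s : Set (Fin 3 → ℝ)} (h0 : ∀ p ∈ s, p 2 ≠ 0) :
    ContinuousOn (powDensity k) s :=
  continuousOn_const.div (((continuous_apply 2).pow k).continuousOn)
    fun p hp => pow_ne_zero k (h0 p hp)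

/-- `[box l u, t^{-k}]` for a rational box not meeting the plane `t = 0`. [folklore] -/
def boxRep (k : ℕ) (l u : Fin 3 → ℚ) (h : 0 < l 2 ∨ u 2 < 0) : KZ.IntegralRep 3 where
  domain := box (fun i => (l i : ℝ)) (fun i => (u i : ℝ))
  integrand := powDensity k
  isSemialgebraic_domain := isSemialgebraic_box l u
  isSemialgebraicFunOn_integrand := by
    refine isSemialgebraicFunOn_powDensity (isSemialgebraic_box l u) (fun p hp => ?_) k
    have h2 := (mem_box.mp hp) 2
    rcases h with h | h
    · exact ne_of_gt (lt_trans (by exact_mod_cast h) h2.1)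
    · exact ne_of_lt (lt_trans h2.2 (by exact_mod_cast h))
  integrableOn := by
    refine (ContinuousOn.integrableOn_compact isCompact_Icc
      (continuousOn_powDensity k fun p hp => ?_)).mono_set (box_subset_Icc _ _)
    have h2l : ((l 2 : ℚ) : ℝ) ≤ p 2 := hp.1 2
    have h2u : p 2 ≤ ((u 2 : ℚ) : ℝ) := hp.2 2
    rcases h with h | h
    · exact ne_of_gt (lt_of_lt_of_le (by exact_mod_cast h) h2l)
    · exact ne_of_lt (lt_of_le_of_lt h2u (by exact_mod_cast h))

/-- Auxiliary: `boxRep_domain`. [folklore] -/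
@[simp] theorem boxRep_domain (k : ℕ) (l u : Fin 3 → ℚ) (h) :
    (boxRep k l u h).domain = box (fun i => (l i : ℝ)) (fun i => (u i : ℝ)) := rfl

/-- Auxiliary: `boxRep_integrand`. [folklore] -/
@[simp] theorem boxRep_integrand (k : ℕ) (l u : Fin 3 → ℚ) (h) :
    (boxRep k l u h).integrand = powDensity k := rfl

/-- Fubini on a coordinate box for an integrand depending on the height only. [folklore] -/
theorem setIntegral_box (l u : Fin 3 → ℝ) (hlu : ∀ i, l i ≤ u i) (φ : ℝ → ℝ) :
    ∫ p in box l u, φ (p 2) = (u 0 - l 0) * (u 1 - l 1) * ∫ t in (l 2)..(u 2), φ t := by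
  have hmeas : MeasurableSet (box l u) := MeasurableSet.univ_pi fun i => measurableSet_Ioo
  let ψ : Fin 3 → ℝ → ℝ := ![fun _ => 1, fun _ => 1, φ]
  let g : Fin 3 → ℝ → ℝ := fun i => (Ioo (l i) (u i)).indicator (ψ i)
  have hind : (box l u).indicator (fun p => φ (p 2)) = fun p => ∏ i, g i (p i) := by
    funext p
    by_cases hp : p ∈ box l u
    · rw [indicator_of_mem hp, Fin.prod_univ_three]
      have h' := mem_box.mp hp
      have e0 : g 0 (p 0) = 1 := indicator_of_mem (s := Ioo (l 0) (u 0)) (h' 0) (ψ 0)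
      have e1 : g 1 (p 1) = 1 := indicator_of_mem (s := Ioo (l 1) (u 1)) (h' 1) (ψ 1)
      have e2 : g 2 (p 2) = φ (p 2) := indicator_of_mem (s := Ioo (l 2) (u 2)) (h' 2) (ψ 2)
      rw [e0, e1, e2]; ring
    · rw [indicator_of_notMem hp]
      have : ∃ i, p i ∉ Ioo (l i) (u i) := by
        by_contra hcon
        push Not at hcon
        exact hp (mem_box.mpr fun i => hcon i)
      obtain ⟨i, hi⟩ := this
      exact (Finset.prod_eq_zero (Finset.mem_univ i)
        (indicator_of_notMem (s := Ioo (l i) (u i)) hi (ψ i))).symm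
  have h0 : ∫ t, g 0 t = u 0 - l 0 := by
    show ∫ t, (Ioo (l 0) (u 0)).indicator (fun _ => (1 : ℝ)) t = _
    rw [MeasureTheory.integral_indicator measurableSet_Ioo, setIntegral_const, smul_eq_mul, mul_one,
      Real.volume_real_Ioo_of_le (hlu 0)]
  have h1 : ∫ t, g 1 t = u 1 - l 1 := by
    show ∫ t, (Ioo (l 1) (u 1)).indicator (fun _ => (1 : ℝ)) t = _
    rw [MeasureTheory.integral_indicator measurableSet_Ioo, setIntegral_const, smul_eq_mul, mul_one,
      Real.volume_real_Ioo_of_le (hlu 1)]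
  have h2 : ∫ t, g 2 t = ∫ t in (l 2)..(u 2), φ t := by
    show ∫ t, (Ioo (l 2) (u 2)).indicator φ t = _
    rw [MeasureTheory.integral_indicator measurableSet_Ioo, ← integral_Ioc_eq_integral_Ioo,
      ← intervalIntegral.integral_of_le (hlu 2)]
  calc ∫ p in box l u, φ (p 2)
      = ∫ p, (box l u).indicator (fun p => φ (p 2)) p := (MeasureTheory.integral_indicator hmeas).symm
    _ = ∫ p : Fin 3 → ℝ, ∏ i, g i (p i) := by rw [hind]
    _ = ∏ i, ∫ t, g i t := integral_fintype_prod_volume_eq_prod g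
    _ = (u 0 - l 0) * (u 1 - l 1) * ∫ t in (l 2)..(u 2), φ t := by
      rw [Fin.prod_univ_three, h0, h1, h2]

/-- Auxiliary: `value_boxRep`. [folklore] -/
theorem value_boxRep (k : ℕ) (l u : Fin 3 → ℚ) (h : 0 < l 2 ∨ u 2 < 0) (hlu : ∀ i, l i ≤ u i) :
    (boxRep k l u h).value =
      ((u 0 : ℝ) - l 0) * ((u 1 : ℝ) - l 1) * ∫ t in (l 2 : ℝ)..(u 2), 1 / t ^ k := by
  have hlu' : ∀ i, (fun i => (l i : ℝ)) i ≤ (fun i => (u i : ℝ)) i := fun i => by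
    show (l i : ℝ) ≤ u i
    exact_mod_cast hlu i
  exact setIntegral_box (fun i => (l i : ℝ)) (fun i => (u i : ℝ)) hlu' (fun t => 1 / t ^ k)

/-- `[s, t^{-k}]` on a Lebesgue-null `ℚ`-semialgebraic set `s` (value `0`). [folklore] -/
def nullRep (k : ℕ) (s : Set (Fin 3 → ℝ)) (hs : IsSemialgebraic ℚ s)
    (hf : IsSemialgebraicFunOn ℚ s (powDensity k)) (h0 : volume s = 0) : KZ.IntegralRep 3 where
  domain := s
  integrand := powDensity k
  isSemialgebraic_domain := hs
  isSemialgebraicFunOn_integrand := hf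
  integrableOn := by
    rw [IntegrableOn, Measure.restrict_eq_zero.mpr h0]
    exact integrable_zero_measure

/-- Auxiliary: `nullRep_domain`. [folklore] -/
@[simp] theorem nullRep_domain (k : ℕ) (s hs hf h0) : (nullRep k s hs hf h0).domain = s := rfl
/-- Auxiliary: `nullRep_integrand`. [folklore] -/
@[simp] theorem nullRep_integrand (k : ℕ) (s hs hf h0) : (nullRep k s hs hf h0).integrand = powDensity k := rfl

/-- Auxiliary: `value_nullRep`. [folklore] -/
theorem value_nullRep (k : ℕ) (s hs hf h0) : (nullRep k s hs hf h0).value = 0 :=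
  setIntegral_measure_zero _ h0

/-- The only refutation channel: the calculus is sound, so inequivalent values forbid `Equivalent`. [folklore] -/
theorem not_equivalent_of_value_ne {r r' : KZ.IntegralRep 3} (h : r.value ≠ r'.value) :
    ¬ KZ.Equivalent r r' :=
  fun he => h (KZ.Equivalent.value_eq_holds he)

/-! ### one-variable integrals `∫_a^b t^{-k} dt` -/

/-- Auxiliary: `intervalIntegrable_powInv`. [folklore] -/
theorem intervalIntegrable_powInv (k : ℕ) {a b : ℝ} (h : (0 : ℝ) ∉ uIcc a b) :
    IntervalIntegrable (fun t : ℝ => 1 / t ^ k) volume a b :=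
  (continuousOn_const.div (continuousOn_pow k) fun _ ht =>
    pow_ne_zero k fun ht0 => h (ht0 ▸ ht)).intervalIntegrable

/-- Auxiliary: `integral_powInv_pos`. [folklore] -/
theorem integral_powInv_pos (k : ℕ) {a b : ℝ} (ha : 0 < a) (hab : a < b) :
    0 < ∫ t in a..b, 1 / t ^ k := by
  refine intervalIntegral_pos_of_pos_on (intervalIntegrable_powInv k ?_) (fun t ht => ?_) hab
  · rw [uIcc_of_le hab.le]; exact fun h0 => (lt_irrefl (0 : ℝ)) (lt_of_lt_of_le ha h0.1)
  · have : 0 < t := ha.trans ht.1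
    positivity

/-- Auxiliary: `integral_powInv_scale`. [folklore] -/
theorem integral_powInv_scale (k : ℕ) (c a b : ℝ) :
    ∫ t in (c * a)..(c * b), 1 / t ^ k = c * ((1 / c ^ k) * ∫ t in a..b, 1 / t ^ k) := by
  rw [← intervalIntegral.smul_integral_comp_mul_left (f := fun t : ℝ => 1 / t ^ k) c, smul_eq_mul]
  congr 1
  simp_rw [mul_pow, ← one_div_mul_one_div]
  exact intervalIntegral.integral_const_mul _ _

/-! ## §1 The crux as one member of a parametrised family

`num a b c d ε p` and `den c d ε p` are VERBATIM the numerator and denominator of the typed map of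
the crux (`w = p 0 + i ε p 1`, `t = p 2`); `IsometryMoveGen Adm height k` is the crux with
(i) the admissibility hypothesis on `(a,b,c,d,ε)` replaced by `Adm`, (ii) the height numerator
`‖ad − bc‖` replaced by `height a b c d`, (iii) the density exponent `3` replaced by `k`.
`isometryMove_iff_gen` anchors the crux at `Adm = (ad − bc ≠ 0 ∧ ε = ±1)`, `height = ‖ad − bc‖`,
`k = 3`. -/

/-- Numerator of the typed Poincaré extension (verbatim from the crux). [folklore] -/
def num (a b c d : ℂ) (ε : ℝ) (p : Fin 3 → ℝ) : ℂ :=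
  (a * (Complex.mk (p 0) (ε * p 1)) + b) * (starRingEnd ℂ) (c * (Complex.mk (p 0) (ε * p 1)) + d) +
    a * (starRingEnd ℂ) c * (p 2 : ℂ) ^ 2

/-- Denominator `N = |cw + d|² + |c|² t²` of the typed Poincaré extension (verbatim). [folklore] -/
def den (c d : ℂ) (ε : ℝ) (p : Fin 3 → ℝ) : ℝ :=
  Complex.normSq (c * (Complex.mk (p 0) (ε * p 1)) + d) + Complex.normSq c * p 2 ^ 2

/-- The admissibility hypothesis of the crux: `ad − bc ≠ 0` and `ε = ±1`. [folklore] -/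
def CruxAdm (a b c d : ℂ) (ε : ℝ) : Prop := a * d - b * c ≠ 0 ∧ (ε = 1 ∨ ε = -1)

/-- The height numerator of the crux: `‖ad − bc‖`. [folklore] -/
def cruxHeight (a b c d : ℂ) : ℝ := ‖a * d - b * c‖

/-- The parametrised family around the crux (see the section docstring). [folklore] -/
def IsometryMoveGen (Adm : ℂ → ℂ → ℂ → ℂ → ℝ → Prop) (height : ℂ → ℂ → ℂ → ℂ → ℝ) (k : ℕ) : Prop :=
  ∀ (a b c d : ℂ) (ε : ℝ), IsAlgebraic ℚ a → IsAlgebraic ℚ b → IsAlgebraic ℚ c → IsAlgebraic ℚ d →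
    Adm a b c d ε →
    ∀ (g : (Fin 3 → ℝ) → (Fin 3 → ℝ)),
      (∀ p, g p = ![(num a b c d ε p).re / den c d ε p, (num a b c d ε p).im / den c d ε p,
        height a b c d * p 2 / den c d ε p]) →
      ∀ (r r' : KZ.IntegralRep 3), r.domain ⊆ {p | 0 < p 2} →
        Set.EqOn r.integrand (powDensity k) r.domain → r'.domain = g '' r.domain →
        Set.EqOn r'.integrand (powDensity k) r'.domain → KZ.Equivalent r r'

/-- ANCHOR: the crux is the member `(CruxAdm, cruxHeight, 3)` of the family (definitional up to
uncurrying `ad − bc ≠ 0 → (ε = 1 ∨ ε = −1) → …`). [folklore] -/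
theorem isometryMove_iff_gen :
    Theses.HyperbolicBloch.IsometryMove ↔ IsometryMoveGen CruxAdm cruxHeight 3 := by
  constructor
  · intro h a b c d ε ha hb hc hd hadm g hg r r' h1 h2 h3 h4
    exact h a b c d ε ha hb hc hd hadm.1 hadm.2 g hg r r' h1 h2 h3 h4
  · intro h a b c d ε ha hb hc hd hdet heps g hg r r' h1 h2 h3 h4
    exact h a b c d ε ha hb hc hd ⟨hdet, heps⟩ g hg r r' h1 h2 h3 h4

/-! ### the diagonal witnesses `a = α ∈ ℝ`, `b = c = 0`, `d = 1` -/

/-- Auxiliary: `den_diag`. [folklore] -/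
@[simp] theorem den_diag (ε : ℝ) (p : Fin 3 → ℝ) : den 0 1 ε p = 1 := by
  simp [den]

/-- Auxiliary: `num_diag`. [folklore] -/
@[simp] theorem num_diag (α ε : ℝ) (p : Fin 3 → ℝ) :
    num α 0 0 1 ε p = α * Complex.mk (p 0) (ε * p 1) := by
  simp [num]

/-- Auxiliary: `cruxHeight_diag`. [folklore] -/
@[simp] theorem cruxHeight_diag (α : ℝ) : cruxHeight α 0 0 1 = |α| := by
  simp [cruxHeight]

/-- Auxiliary: `cruxAdm_diag`. [folklore] -/
theorem cruxAdm_diag {α ε : ℝ} (hα : α ≠ 0) (hε : ε = 1 ∨ ε = -1) : CruxAdm α 0 0 1 ε :=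
  ⟨by simpa using hα, hε⟩

/-- At the diagonal witnesses the typed map is the diagonal linear map
`diag(α, αε, height)`. [folklore] -/
theorem formula_diag (α ε h : ℝ) (p : Fin 3 → ℝ) :
    ![(num α 0 0 1 ε p).re / den 0 1 ε p, (num α 0 0 1 ε p).im / den 0 1 ε p,
        h * p 2 / den 0 1 ε p] = fun i => ![α, α * ε, h] i * p i := by
  ext i
  fin_cases i
  · simp [Complex.mul_re]
  · simp [Complex.mul_im]
    ring
  · simp

/-- The diagonal linear map `p ↦ (Dᵢ pᵢ)ᵢ`. [folklore] -/
def diagMap (D : Fin 3 → ℝ) : (Fin 3 → ℝ) → (Fin 3 → ℝ) := fun p i => D i * p i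

/-- Auxiliary: `diagMap_image_pi`. [folklore] -/
theorem diagMap_image_pi (D : Fin 3 → ℝ) (S : Fin 3 → Set ℝ) :
    diagMap D '' Set.pi univ S = Set.pi univ fun i => (fun t => D i * t) '' S i :=
  piMap_image_univ_pi (fun i => fun t => D i * t) S

/-- Auxiliary: `image_mul_left_Ioo_of_neg`. [folklore] -/
theorem image_mul_left_Ioo_of_neg {c : ℝ} (hc : c < 0) (a b : ℝ) :
    (fun t => c * t) '' Ioo a b = Ioo (c * b) (c * a) := by
  ext x
  constructor
  · rintro ⟨t, ⟨hta, htb⟩, rfl⟩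
    exact ⟨mul_lt_mul_of_neg_left htb hc, mul_lt_mul_of_neg_left hta hc⟩
  · rintro ⟨hxb, hxa⟩
    refine ⟨x / c, ⟨?_, ?_⟩, mul_div_cancel₀ x hc.ne⟩
    · rwa [lt_div_iff_of_neg hc, mul_comm]
    · rwa [div_lt_iff_of_neg hc, mul_comm]

/-- Auxiliary: `image_mul_left_zero`. [folklore] -/
theorem image_mul_left_zero {a b : ℝ} (hab : a < b) :
    (fun t => (0 : ℝ) * t) '' Ioo a b = {0} := by
  simp only [zero_mul]
  exact (nonempty_Ioo.mpr hab).image_const 0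

/-- MASTER REFUTATION LEMMA. A member of the family is false as soon as one diagonal witness
`(α, 0, 0, 1, ε)` is admissible and transports some representation `r` (domain in `{t > 0}`,
density `t^{-k}`) to a representation `r'` on the image with a DIFFERENT value: soundness of the
calculus (`KZ.Equivalent.value_eq_holds`) forbids `Equivalent r r'`. [folklore] -/
theorem gen_false_of_diag {Adm : ℂ → ℂ → ℂ → ℂ → ℝ → Prop} {height : ℂ → ℂ → ℂ → ℂ → ℝ} {k : ℕ}
    (α ε : ℝ) (hα : IsAlgebraic ℚ (α : ℂ)) (hadm : Adm α 0 0 1 ε)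
    (D : Fin 3 → ℝ) (hD : (![α, α * ε, height α 0 0 1] : Fin 3 → ℝ) = D)
    (r r' : KZ.IntegralRep 3) (hdom : r.domain ⊆ {p | 0 < p 2})
    (hint : Set.EqOn r.integrand (powDensity k) r.domain)
    (himg : r'.domain = diagMap D '' r.domain)
    (hint' : Set.EqOn r'.integrand (powDensity k) r'.domain) (hne : r.value ≠ r'.value) :
    ¬ IsometryMoveGen Adm height k := by
  intro hV
  refine not_equivalent_of_value_ne hne
    (hV α 0 0 1 ε hα isAlgebraic_zero isAlgebraic_zero isAlgebraic_one hadm _ (fun p => rfl)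
      r r' hdom hint ?_ hint')
  rw [himg, ← hD]
  congr 1
  funext p
  exact (formula_diag α ε (height α 0 0 1) p).symm

/-- Auxiliary: `pi_eq_pi`. [folklore] -/
theorem pi_eq_pi {S T : Fin 3 → Set ℝ} (h0 : S 0 = T 0) (h1 : S 1 = T 1) (h2 : S 2 = T 2) :
    Set.pi univ S = Set.pi univ T := by
  have : S = T := by
    funext i
    fin_cases i
    · exact h0
    · exact h1
    · exact h2
  rw [this]

/-- Auxiliary: `volume_pi_eq_zero`. [folklore] -/
theorem volume_pi_eq_zero {S : Fin 3 → Set ℝ} (i : Fin 3) (hi : volume (S i) = 0) :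
    volume (Set.pi univ S) = 0 := by
  rw [volume_pi_pi]
  exact Finset.prod_eq_zero (Finset.mem_univ i) hi

/-- The reference representation: the unit box `(0,1)² × (1,2)` with density `t^{-k}`. [folklore] -/
def unitBoxRep (k : ℕ) : KZ.IntegralRep 3 := boxRep k ![0, 0, 1] ![1, 1, 2] (Or.inl (by simp))

/-- Auxiliary: `unitBoxRep_domain_subset`. [folklore] -/
theorem unitBoxRep_domain_subset (k : ℕ) : (unitBoxRep k).domain ⊆ {p | 0 < p 2} := by
  intro p hp
  have h2 := (mem_box.mp hp) 2
  have : (1 : ℝ) < p 2 := by simpa using h2.1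
  exact lt_trans zero_lt_one this

/-- Auxiliary: `value_unitBoxRep`. [folklore] -/
theorem value_unitBoxRep (k : ℕ) : (unitBoxRep k).value = ∫ t in (1 : ℝ)..2, 1 / t ^ k := by
  rw [unitBoxRep, value_boxRep k _ _ _ (fun i => by fin_cases i <;> simp)]
  simp

/-- Auxiliary: `value_unitBoxRep_pos`. [folklore] -/
theorem value_unitBoxRep_pos (k : ℕ) : 0 < (unitBoxRep k).value := by
  rw [value_unitBoxRep]
  exact integral_powInv_pos k zero_lt_one one_lt_two

end Summit.KontsevichZagierPeriods.HyperbolicBloch.IsometryMoveNegative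

end
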